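import Mathlib.Data.List.Rotate
import Mathlib.Data.List.Nodup
import Mathlib.Data.List.Chain
import Mathlib.Data.List.TakeWhile
import Mathlib.Algebra.BigOperators.Group.List.Basic
import Mathlib.Algebra.Order.Group.Abs
import HarnessLib

/-!
# Cyclic consecutive pairs of a list, weaving and un-weaving

Generic list combinatorics for closed lattice paths read as cyclic vertex lists (used by the
column surgery — "haruspicy" — on square-lattice self-avoiding polygons,
`Literature/Combinatorics/Enumerative/LatticePolygons.lean`): all the bookkeeping of a closed
path is about its list of cyclically consecutive pairs (its bonds).

* `consecPairs l = [(l₀,l₁), (l₁,l₂), …]` (linear) and `cycPairs l` (cyclic: also `(l_{N-1}, l₀)`);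
  behaviour under `rotate`, `reverse`, `map`; indexing; in a duplicate-free list a cyclic pair
  is determined by either component, is not a loop (`N ≥ 2`), and never occurs in both
  orientations (`N ≥ 3`, `swap_not_mem_cycPairs`: a cycle traverses each edge once).
* `cycWeave F G K`: replace every element `a` of the cyclic list `K`, cyclically followed by
  `b`, by the block `F a :: G a b` (edge subdivision); its cyclic pairs (`cycPairs_cycWeave`),
  length, members, filter, duplicate-freeness.
* `blocksOf P l`: the converse decomposition of a list whose head satisfies `P` into blocks
  (`P`-element, maximal run of following non-`P` elements), and the un-weaving identity
  `eq_cycWeave_filter`.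
* telescoping along a cyclic list (`sum_map_cycPairs_sub`) and its consequence for an
  integer-valued function: up-crossings and down-crossings of a threshold are equinumerous
  (`countP_upCross_eq_countP_downCross`) and exist as soon as the threshold separates two
  values (`exists_upCross`) — the discrete "a closed curve crosses a line an even number of
  times".

All statements are folklore; nothing here is specific to the plane. Declarations live in
namespace `Literature` (not `List`, to stay out of core/Mathlib namespaces), so they are applied as
functions (`cycPairs l`), not with dot notation.
-/

namespace Literature.Combinatorics.Enumerative

open List

variable {α β γ : Type*}

/-! ### Linear consecutive pairs -/

/-- The list of consecutive pairs `[(l₀,l₁), (l₁,l₂), …, (l_{n-2}, l_{n-1})]` of a list.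
[folklore] -/
def consecPairs (l : List α) : List (α × α) := l.zip l.tail

/-- `consecPairs [] = []`. [folklore] -/
@[simp] theorem consecPairs_nil : consecPairs ([] : List α) = [] := rfl

/-- `consecPairs [a] = []`. [folklore] -/
@[simp] theorem consecPairs_singleton (a : α) : consecPairs [a] = [] := rfl

/-- `consecPairs (a :: b :: l) = (a, b) :: consecPairs (b :: l)`. [folklore] -/
@[simp] theorem consecPairs_cons_cons (a b : α) (l : List α) :
    consecPairs (a :: b :: l) = (a, b) :: consecPairs (b :: l) := rfl

/-- `consecPairs l` has `length l - 1` entries. [folklore] -/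
@[simp] theorem length_consecPairs (l : List α) : (consecPairs l).length = l.length - 1 := by
  unfold consecPairs
  rw [length_zip, length_tail]
  omega

/-- Splitting `consecPairs` at an interior point. [folklore] -/
theorem consecPairs_append_cons (l₁ l₂ : List α) (b : α) :
    consecPairs (l₁ ++ b :: l₂) = consecPairs (l₁ ++ [b]) ++ consecPairs (b :: l₂) := by
  induction l₁ with
  | nil => simp
  | cons a l₁ ih =>
    cases l₁ with
    | nil => simp
    | cons a' l₁ =>
      simp only [cons_append, consecPairs_cons_cons] at ih ⊢
      rw [ih]

/-- Splitting `consecPairs` at an interior point (cons form). [folklore] -/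
theorem consecPairs_cons_append_cons (a b : α) (l₁ l₂ : List α) :
    consecPairs (a :: (l₁ ++ b :: l₂)) = consecPairs (a :: (l₁ ++ [b])) ++ consecPairs (b :: l₂) := by
  rw [← cons_append, consecPairs_append_cons, cons_append]

/-- `consecPairs` of a snoc. [folklore] -/
theorem consecPairs_append_singleton (l : List α) (a b : α) :
    consecPairs (l ++ [a] ++ [b]) = consecPairs (l ++ [a]) ++ [(a, b)] := by
  rw [List.append_assoc, singleton_append, consecPairs_append_cons]
  rfl

/-- A relation holds along a list iff it holds on all consecutive pairs. [folklore] -/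
theorem isChain_iff_forall_consecPairs {R : α → α → Prop} {l : List α} :
    IsChain R l ↔ ∀ p ∈ consecPairs l, R p.1 p.2 := by
  induction l with
  | nil => simp
  | cons a l ih =>
    cases l with
    | nil => simp
    | cons b l =>
      rw [isChain_cons_cons, ih]
      simp

/-- `consecPairs` commutes with `map`. [folklore] -/
theorem consecPairs_map (f : α → β) (l : List α) :
    consecPairs (l.map f) = (consecPairs l).map (Prod.map f f) := by
  unfold consecPairs
  rw [← map_tail, zip_map]

/-- First components of `consecPairs l`. [folklore] -/
theorem map_fst_consecPairs (l : List α) : (consecPairs l).map Prod.fst = l.dropLast := by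
  induction l with
  | nil => rfl
  | cons a l ih =>
    cases l with
    | nil => rfl
    | cons b l =>
      rw [consecPairs_cons_cons, map_cons, ih, dropLast_cons_cons]

/-- Second components of `consecPairs l`. [folklore] -/
theorem map_snd_consecPairs (l : List α) : (consecPairs l).map Prod.snd = l.tail := by
  induction l with
  | nil => rfl
  | cons a l ih =>
    cases l with
    | nil => rfl
    | cons b l =>
      rw [consecPairs_cons_cons, map_cons, ih]
      rfl

/-- Members of `consecPairs l` have both components in `l`. [folklore] -/
theorem mem_of_mem_consecPairs {l : List α} {p : α × α} (h : p ∈ consecPairs l) :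
    p.1 ∈ l ∧ p.2 ∈ l := by
  obtain ⟨a, b⟩ := p
  have := of_mem_zip h
  exact ⟨this.1, mem_of_mem_tail this.2⟩

/-- `consecPairs` of a reversed list: reverse the list of swapped pairs. [folklore] -/
theorem consecPairs_reverse (l : List α) :
    consecPairs l.reverse = ((consecPairs l).map Prod.swap).reverse := by
  induction l with
  | nil => rfl
  | cons a l ih =>
    cases l with
    | nil => rfl
    | cons b l =>
      rw [consecPairs_cons_cons, map_cons, reverse_cons (a := (a, b).swap), reverse_cons,
        ← ih, Prod.swap_prod_mk, reverse_cons, List.append_assoc, List.singleton_append,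
        consecPairs_append_cons, ← reverse_cons]
      rfl

/-- Indexing `consecPairs`. [folklore] -/
theorem getElem_consecPairs (l : List α) (i : ℕ) (h : i < (consecPairs l).length) :
    (consecPairs l)[i] = (l[i]'(by simp at h; omega), l[i + 1]'(by simp at h; omega)) := by
  unfold consecPairs
  rw [getElem_zip]
  simp

/-- Membership in `consecPairs` via indices. [folklore] -/
theorem mem_consecPairs_iff {l : List α} {p : α × α} :
    p ∈ consecPairs l ↔ ∃ (i : ℕ) (h : i + 1 < l.length), l[i] = p.1 ∧ l[i + 1] = p.2 := by
  rw [mem_iff_getElem]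
  constructor
  · rintro ⟨i, hi, rfl⟩
    refine ⟨i, by simp at hi; omega, ?_⟩
    rw [getElem_consecPairs]
    simp
  · rintro ⟨i, hi, h1, h2⟩
    refine ⟨i, by simp; omega, ?_⟩
    rw [getElem_consecPairs]
    exact Prod.ext h1 h2

/-! ### Cyclic consecutive pairs -/

/-- The list of cyclically consecutive pairs `[(l₀,l₁), …, (l_{N-2}, l_{N-1}), (l_{N-1}, l₀)]`.
[folklore] -/
def cycPairs : List α → List (α × α)
  | [] => []
  | a :: l => consecPairs (a :: l ++ [a])

/-- `cycPairs [] = []`. [folklore] -/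
@[simp] theorem cycPairs_nil : cycPairs ([] : List α) = [] := rfl

/-- Unfolding `cycPairs` on a nonempty list. [folklore] -/
theorem cycPairs_cons (a : α) (l : List α) : cycPairs (a :: l) = consecPairs (a :: l ++ [a]) := rfl

/-- Unfolding `cycPairs` via `head`. [folklore] -/
theorem cycPairs_eq_consecPairs (l : List α) (h : l ≠ []) :
    cycPairs l = consecPairs (l ++ [l.head h]) := by
  cases l with
  | nil => exact absurd rfl h
  | cons a l => rfl

/-- `zip` ignores a suffix of its first argument beyond the length of the second. [folklore] -/
theorem zip_append_left_of_length_le (l₁ l₂ : List α) (l₃ : List β) (h : l₃.length ≤ l₁.length) :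
    (l₁ ++ l₂).zip l₃ = l₁.zip l₃ := by
  induction l₁ generalizing l₃ with
  | nil =>
    cases l₃ with
    | nil => simp
    | cons _ _ => simp at h
  | cons a l₁ ih =>
    cases l₃ with
    | nil => simp
    | cons c l₃ =>
      simp only [cons_append, zip_cons_cons, cons.injEq, true_and]
      exact ih l₃ (by simpa using h)

/-- `cycPairs l` is `l` zipped with its rotation by one. [folklore] -/
theorem cycPairs_eq_zip_rotate (l : List α) : cycPairs l = l.zip (l.rotate 1) := by
  cases l with
  | nil => rfl
  | cons a l =>
    rw [cycPairs_cons, rotate_cons_succ, rotate_zero, consecPairs, cons_append, tail_cons,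
      ← cons_append, zip_append_left_of_length_le _ _ _ (by simp)]

/-- `cycPairs l` has as many entries as `l`. [folklore] -/
@[simp] theorem length_cycPairs (l : List α) : (cycPairs l).length = l.length := by
  cases l with
  | nil => rfl
  | cons a l => simp [cycPairs_cons]

/-- First components of `cycPairs l` give back `l`. [folklore] -/
@[simp] theorem map_fst_cycPairs (l : List α) : (cycPairs l).map Prod.fst = l := by
  rw [cycPairs_eq_zip_rotate, map_fst_zip]
  simp

/-- Second components of `cycPairs l` give `l` rotated by one. [folklore] -/
@[simp] theorem map_snd_cycPairs (l : List α) : (cycPairs l).map Prod.snd = l.rotate 1 := by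
  rw [cycPairs_eq_zip_rotate, map_snd_zip]
  simp

/-- Members of `cycPairs l` have both components in `l`. [folklore] -/
theorem mem_of_mem_cycPairs {l : List α} {p : α × α} (h : p ∈ cycPairs l) : p.1 ∈ l ∧ p.2 ∈ l := by
  constructor
  · rw [← map_fst_cycPairs l]; exact mem_map_of_mem h
  · rw [← mem_rotate (n := 1), ← map_snd_cycPairs l]; exact mem_map_of_mem h

/-- `cycPairs` commutes with `map`. [folklore] -/
theorem cycPairs_map (f : α → β) (l : List α) :
    cycPairs (l.map f) = (cycPairs l).map (Prod.map f f) := by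
  rw [cycPairs_eq_zip_rotate, cycPairs_eq_zip_rotate, ← map_rotate, zip_map]

/-- `cycPairs` commutes with rotation. [folklore] -/
theorem cycPairs_rotate (l : List α) (k : ℕ) : cycPairs (l.rotate k) = (cycPairs l).rotate k := by
  rw [cycPairs_eq_zip_rotate, cycPairs_eq_zip_rotate, rotate_rotate, zip_eq_zipWith, zip_eq_zipWith,
    zipWith_rotate_distrib _ _ _ _ (by simp), rotate_rotate, Nat.add_comm]

/-- Indexing `cycPairs`: the `i`-th pair is `(l[i], l[(i+1) % N])`. [folklore] -/
theorem getElem_cycPairs (l : List α) (i : ℕ) (h : i < (cycPairs l).length) :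
    (cycPairs l)[i] =
      (l[i]'(by simpa using h), l[(i + 1) % l.length]'(Nat.mod_lt _ (by simp at h; omega))) := by
  have hl : i < l.length := by simpa using h
  simp only [cycPairs_eq_zip_rotate, getElem_zip, getElem_rotate]

/-- Membership in `cycPairs` via indices. [folklore] -/
theorem mem_cycPairs_iff {l : List α} {p : α × α} :
    p ∈ cycPairs l ↔ ∃ (i : ℕ) (h : i < l.length), l[i] = p.1 ∧
      l[(i + 1) % l.length]'(Nat.mod_lt _ (by omega)) = p.2 := by
  rw [mem_iff_getElem]
  constructor
  · rintro ⟨i, hi, rfl⟩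
    refine ⟨i, by simpa using hi, ?_⟩
    rw [getElem_cycPairs]
    simp
  · rintro ⟨i, hi, h1, h2⟩
    refine ⟨i, by simpa using hi, ?_⟩
    rw [getElem_cycPairs]
    exact Prod.ext h1 h2

/-- The pair starting at index `i`. [folklore] -/
theorem getElem_mem_cycPairs (l : List α) (i : ℕ) (hi : i < l.length) :
    (l[i], l[(i + 1) % l.length]'(Nat.mod_lt _ (by omega))) ∈ cycPairs l :=
  mem_cycPairs_iff.2 ⟨i, hi, rfl, rfl⟩

/-- The closing pair `(last, head)` is a cyclic pair. [folklore] -/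
theorem getLast_head_mem_cycPairs (l : List α) (h : l ≠ []) : (l.getLast h, l.head h) ∈ cycPairs l := by
  have hl : 0 < l.length := length_pos_of_ne_nil h
  refine mem_cycPairs_iff.2 ⟨l.length - 1, by omega, ?_, ?_⟩
  · simp [getLast_eq_getElem]
  · simp only [Nat.sub_add_cancel hl, Nat.mod_self, head_eq_getElem]

/-- The first bond `(l[0], l[1])` is a cyclic pair. [folklore] -/
theorem getElem_zero_one_mem_cycPairs (l : List α) (h : 2 ≤ l.length) :
    (l[0]'(by omega), l[1]'(by omega)) ∈ cycPairs l := by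
  have := getElem_mem_cycPairs l 0 (by omega)
  have h1 : (0 + 1) % l.length = 1 := Nat.mod_eq_of_lt (by omega)
  simp only [h1] at this
  exact this

/-- The closing bond `(l[N-1], l[0])` is a cyclic pair. [folklore] -/
theorem getElem_length_sub_one_zero_mem_cycPairs (l : List α) (h : 0 < l.length) :
    (l[l.length - 1]'(by omega), l[0]'h) ∈ cycPairs l := by
  have := getElem_mem_cycPairs l (l.length - 1) (by omega)
  have h1 : (l.length - 1 + 1) % l.length = 0 := by rw [Nat.sub_add_cancel h, Nat.mod_self]
  simp only [h1] at this
  exact this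

/-- Rotation does not change the set of cyclic pairs. [folklore] -/
theorem mem_cycPairs_rotate_iff {l : List α} {k : ℕ} {p : α × α} :
    p ∈ cycPairs (l.rotate k) ↔ p ∈ cycPairs l := by
  rw [cycPairs_rotate, mem_rotate]

/-- Linear consecutive pairs are cyclic pairs. [folklore] -/
theorem consecPairs_subset_cycPairs (l : List α) : consecPairs l ⊆ cycPairs l := by
  intro p hp
  obtain ⟨i, hi, h1, h2⟩ := mem_consecPairs_iff.1 hp
  refine mem_cycPairs_iff.2 ⟨i, by omega, h1, ?_⟩
  simp only [Nat.mod_eq_of_lt hi, h2]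

/-- A cyclic pair is either a linear consecutive pair or the closing pair. [folklore] -/
theorem mem_cycPairs_cases {l : List α} {p : α × α} (hp : p ∈ cycPairs l) (h : l ≠ []) :
    p ∈ consecPairs l ∨ p = (l.getLast h, l.head h) := by
  obtain ⟨i, hi, h1, h2⟩ := mem_cycPairs_iff.1 hp
  rcases Nat.lt_or_ge (i + 1) l.length with hlt | hge
  · left
    refine mem_consecPairs_iff.2 ⟨i, hlt, h1, ?_⟩
    rw [← h2]
    simp only [Nat.mod_eq_of_lt hlt]
  · right
    have hi' : i = l.length - 1 := by omega
    subst hi'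
    have hN : l.length - 1 + 1 = l.length := by omega
    simp only [hN, Nat.mod_self] at h2
    refine Prod.ext ?_ ?_
    · rw [← h1, getLast_eq_getElem]
    · rw [← h2, head_eq_getElem]

/-- In a duplicate-free list, `cycPairs l` is duplicate-free. [folklore] -/
theorem nodup_cycPairs {l : List α} (h : l.Nodup) : (cycPairs l).Nodup := by
  have := map_fst_cycPairs l
  rw [← this] at h
  exact h.of_map _

/-- In a duplicate-free list, a cyclic pair is determined by its first component. [folklore] -/
theorem cycPairs_eq_of_fst_eq {l : List α} (h : l.Nodup) {p q : α × α} (hp : p ∈ cycPairs l)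
    (hq : q ∈ cycPairs l) (he : p.1 = q.1) : p = q := by
  have h' : (cycPairs l).map Prod.fst |>.Nodup := by rwa [map_fst_cycPairs]
  rw [nodup_map_iff_inj_on (nodup_cycPairs h)] at h'
  exact h' p hp q hq he

/-- In a duplicate-free list, a cyclic pair is determined by its second component. [folklore] -/
theorem cycPairs_eq_of_snd_eq {l : List α} (h : l.Nodup) {p q : α × α} (hp : p ∈ cycPairs l)
    (hq : q ∈ cycPairs l) (he : p.2 = q.2) : p = q := by
  have h' : (cycPairs l).map Prod.snd |>.Nodup := by rwa [map_snd_cycPairs, nodup_rotate]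
  rw [nodup_map_iff_inj_on (nodup_cycPairs h)] at h'
  exact h' p hp q hq he

/-- In a duplicate-free list with at least two elements, cyclic pairs are not loops. [folklore] -/
theorem fst_ne_snd_of_mem_cycPairs {l : List α} (h : l.Nodup) (h2 : 2 ≤ l.length) {p : α × α}
    (hp : p ∈ cycPairs l) : p.1 ≠ p.2 := by
  obtain ⟨i, hi, h1, h2'⟩ := mem_cycPairs_iff.1 hp
  rw [← h1, ← h2', Ne, h.getElem_inj_iff]
  intro e
  rcases Nat.lt_or_ge (i + 1) l.length with hlt | hge
  · rw [Nat.mod_eq_of_lt hlt] at e; omega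
  · have : i + 1 = l.length := by omega
    rw [this, Nat.mod_self] at e; omega

/-- In a duplicate-free list with at least three elements no pair occurs in both orientations
among the cyclic pairs (an edge of a cycle of length `≥ 3` is traversed once). [folklore] -/
theorem swap_not_mem_cycPairs {l : List α} (h : l.Nodup) (h3 : 3 ≤ l.length) {p : α × α}
    (hp : p ∈ cycPairs l) : p.swap ∉ cycPairs l := by
  intro hq
  obtain ⟨i, hi, hi1, hi2⟩ := mem_cycPairs_iff.1 hp
  obtain ⟨j, hj, hj1, hj2⟩ := mem_cycPairs_iff.1 hq
  simp only [Prod.fst_swap, Prod.snd_swap] at hj1 hj2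
  have e1 : l[(i + 1) % l.length]'(Nat.mod_lt _ (by omega)) = l[j] := by rw [hi2, hj1]
  have e2 : l[(j + 1) % l.length]'(Nat.mod_lt _ (by omega)) = l[i] := by rw [hj2, hi1]
  rw [h.getElem_inj_iff] at e1 e2
  rcases Nat.lt_or_ge (i + 1) l.length with hi' | hi'
  · rw [Nat.mod_eq_of_lt hi'] at e1
    rcases Nat.lt_or_ge (j + 1) l.length with hj' | hj'
    · rw [Nat.mod_eq_of_lt hj'] at e2; omega
    · rw [show j + 1 = l.length by omega, Nat.mod_self] at e2; omega
  · rw [show i + 1 = l.length by omega, Nat.mod_self] at e1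
    rcases Nat.lt_or_ge (j + 1) l.length with hj' | hj'
    · rw [Nat.mod_eq_of_lt hj'] at e2; omega
    · rw [show j + 1 = l.length by omega, Nat.mod_self] at e2; omega

/-- Consecutive cyclic pairs chain: if `(a, b)` and `(b', c)` are consecutive in `cycPairs l`
(cyclically), then `b' = b`. [folklore] -/
theorem snd_eq_fst_of_mem_cycPairs_cycPairs {l : List α} {P Q : α × α}
    (h : (P, Q) ∈ cycPairs (cycPairs l)) : Q.1 = P.2 := by
  obtain ⟨i, hi, h1, h2⟩ := mem_cycPairs_iff.1 h
  simp only at h1 h2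
  rw [← h1, ← h2, getElem_cycPairs, getElem_cycPairs]
  simp

/-- The cyclic pairs of a reversed list are, up to order, the swapped cyclic pairs. [folklore] -/
theorem cycPairs_reverse_perm (l : List α) : cycPairs l.reverse ~ (cycPairs l).map Prod.swap := by
  cases l with
  | nil => exact Perm.refl _
  | cons a l =>
    obtain ⟨l', b, hl'⟩ : ∃ l' b, a :: l = l' ++ [b] :=
      ⟨_, _, (dropLast_append_getLast (cons_ne_nil a l)).symm⟩
    have hb : (a :: l).getLast (cons_ne_nil a l) = b := by simp [hl']
    have hne : (a :: l).reverse ≠ [] := by simp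
    have h1 : cycPairs (a :: l).reverse =
        ((a, b) :: (consecPairs (a :: l)).map Prod.swap).reverse := by
      rw [cycPairs_eq_consecPairs _ hne, head_reverse, hb, ← reverse_cons, consecPairs_reverse,
        consecPairs_cons_cons, map_cons]
      rfl
    have h2 : (cycPairs (a :: l)).map Prod.swap =
        (consecPairs (a :: l)).map Prod.swap ++ [(a, b)] := by
      rw [cycPairs_cons, hl', consecPairs_append_singleton, map_append]
      rfl
    rw [h1, h2]
    exact (reverse_perm _).trans (isRotated_concat _ _).perm.symm

/-! ### Blocks and weaving -/

/-- A block `(a, t)` stands for the nonempty list `a :: t`. [folklore] -/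
def blkList (b : α × List α) : List α := b.1 :: b.2

/-- `blkList (a, t) = a :: t`. [folklore] -/
@[simp] theorem blkList_mk (a : α) (t : List α) : blkList (a, t) = a :: t := rfl

/-- Consecutive pairs of a concatenation of nonempty blocks followed by a final element: the
pairs inside each block closed up by the head of the next block (or the final element).
[folklore] -/
theorem consecPairs_flatMap_blkList_append (bs : List (α × List α)) (z : α) :
    consecPairs (bs.flatMap blkList ++ [z]) =
      (bs.zip (bs.tail.map Prod.fst ++ [z])).flatMap
        fun q => consecPairs (q.1.1 :: q.1.2 ++ [q.2]) := by
  induction bs with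
  | nil => simp
  | cons b bs ih =>
    obtain ⟨a, t⟩ := b
    cases bs with
    | nil => simp
    | cons b' bs =>
      obtain ⟨a', t'⟩ := b'
      simp only [flatMap_cons, blkList_mk, cons_append, List.append_assoc] at ih ⊢
      rw [consecPairs_cons_append_cons, ih]
      simp

/-- Cyclic pairs of a concatenation of nonempty blocks: the pairs inside each block closed up by
the head of the cyclically next block. [folklore] -/
theorem cycPairs_flatMap_blkList (bs : List (α × List α)) :
    cycPairs (bs.flatMap blkList) =
      (cycPairs bs).flatMap fun q => consecPairs (q.1.1 :: q.1.2 ++ [q.2.1]) := by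
  cases bs with
  | nil => rfl
  | cons b bs =>
    have hne : (b :: bs).flatMap blkList ≠ [] := by simp [blkList]
    rw [cycPairs_eq_consecPairs _ hne]
    have hh : ((b :: bs).flatMap blkList).head hne = b.1 := by simp [blkList]
    rw [hh, consecPairs_flatMap_blkList_append, cycPairs_eq_zip_rotate, rotate_cons_succ, rotate_zero,
      tail_cons]
    have : (b :: bs).zip (bs.map Prod.fst ++ [b.1]) =
        ((b :: bs).zip (bs ++ [b])).map (Prod.map id Prod.fst) := by
      rw [← zip_map_right, map_append, map_cons, map_nil]
    rw [this, flatMap_map]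
    rfl

/-- **Weaving**: replace every element `a` of the cyclic list `K`, cyclically followed by `b`,
by the block `F a :: G a b`. [folklore] -/
def cycWeave (F : α → β) (G : α → α → List β) (K : List α) : List β :=
  (cycPairs K).flatMap fun p => F p.1 :: G p.1 p.2

/-- `cycWeave` of the empty list. [folklore] -/
@[simp] theorem cycWeave_nil (F : α → β) (G : α → α → List β) : cycWeave F G [] = [] := rfl

/-- `cycWeave` as a concatenation of blocks. [folklore] -/
theorem cycWeave_eq_flatMap_blkList (F : α → β) (G : α → α → List β) (K : List α) :
    cycWeave F G K = ((cycPairs K).map fun p => (F p.1, G p.1 p.2)).flatMap blkList := by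
  rw [cycWeave, flatMap_map]
  rfl

/-- A flat map over `cycPairs K` that only uses first components is a flat map over `K`.
[folklore] -/
theorem flatMap_cycPairs_fst (K : List α) (f : α → List β) :
    ((cycPairs K).flatMap fun p => f p.1) = K.flatMap f := by
  conv_rhs => rw [← map_fst_cycPairs K]
  rw [flatMap_map]

/-- **Cyclic pairs of a weave**: the consecutive pairs of each block `F a :: G a b ++ [F b]`.
[folklore] -/
theorem cycPairs_cycWeave (F : α → β) (G : α → α → List β) (K : List α) :
    cycPairs (cycWeave F G K) =
      (cycPairs K).flatMap fun p => consecPairs (F p.1 :: G p.1 p.2 ++ [F p.2]) := by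
  rw [cycWeave_eq_flatMap_blkList, cycPairs_flatMap_blkList, cycPairs_map, flatMap_map,
    ← flatMap_cycPairs_fst (cycPairs K)]
  refine flatMap_congr fun q hq => ?_
  have := snd_eq_fst_of_mem_cycPairs_cycPairs (P := q.1) (Q := q.2) hq
  simp [this]

/-- The length of a weave. [folklore] -/
theorem length_cycWeave (F : α → β) (G : α → α → List β) (K : List α) :
    (cycWeave F G K).length = K.length + ((cycPairs K).map fun p => (G p.1 p.2).length).sum := by
  rw [cycWeave, length_flatMap]
  simp only [length_cons]
  suffices h : ∀ L : List (α × α), (L.map fun p => (G p.1 p.2).length + 1).sum =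
      L.length + (L.map fun p => (G p.1 p.2).length).sum by
    rw [h, length_cycPairs]
  intro L
  induction L with
  | nil => simp
  | cons p L ih =>
    simp only [map_cons, sum_cons, length_cons]
    rw [ih]
    omega

/-- Membership in a weave. [folklore] -/
theorem mem_cycWeave_iff {F : α → β} {G : α → α → List β} {K : List α} {x : β} :
    x ∈ cycWeave F G K ↔ (∃ a ∈ K, F a = x) ∨ ∃ p ∈ cycPairs K, x ∈ G p.1 p.2 := by
  simp only [cycWeave, mem_flatMap, mem_cons]
  constructor
  · rintro ⟨p, hp, rfl | h⟩
    · exact Or.inl ⟨p.1, (mem_of_mem_cycPairs hp).1, rfl⟩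
    · exact Or.inr ⟨p, hp, h⟩
  · rintro (⟨a, ha, rfl⟩ | ⟨p, hp, h⟩)
    · obtain ⟨i, hi, rfl⟩ := mem_iff_getElem.1 ha
      exact ⟨_, getElem_mem_cycPairs K i hi, Or.inl rfl⟩
    · exact ⟨p, hp, Or.inr h⟩

/-- Filtering a weave by a predicate that holds on the block heads and fails on the fillers
returns the (mapped) skeleton. [folklore] -/
theorem filter_cycWeave (F : α → β) (G : α → α → List β) (K : List α) (P : β → Bool)
    (hF : ∀ a ∈ K, P (F a) = true) (hG : ∀ p ∈ cycPairs K, ∀ x ∈ G p.1 p.2, P x = false) :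
    (cycWeave F G K).filter P = K.map F := by
  rw [cycWeave, filter_flatMap]
  conv_rhs => rw [← map_fst_cycPairs K, map_map]
  rw [← flatMap_singleton' ((cycPairs K).map (F ∘ Prod.fst)), flatMap_map]
  refine flatMap_congr fun p hp => ?_
  rw [filter_cons_of_pos (hF _ (mem_of_mem_cycPairs hp).1), Function.comp_apply,
    cons.injEq, filter_eq_nil_iff]
  exact ⟨rfl, fun x hx => by simp [hG p hp x hx]⟩

/-- The head of a weave of a nonempty list is the image of its head. [folklore] -/
theorem head?_cycWeave (F : α → β) (G : α → α → List β) (K : List α) :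
    (cycWeave F G K).head? = K.head?.map F := by
  cases K with
  | nil => rfl
  | cons a K =>
    rw [cycWeave, cycPairs_cons]
    cases K with
    | nil => simp
    | cons b K => simp

/-- A weave is duplicate-free if the skeleton is, each block is, and distinct blocks are
disjoint. [folklore] -/
theorem nodup_cycWeave {F : α → β} {G : α → α → List β} {K : List α} (hK : K.Nodup)
    (hblk : ∀ p ∈ cycPairs K, (F p.1 :: G p.1 p.2).Nodup)
    (hdisj : ∀ p ∈ cycPairs K, ∀ q ∈ cycPairs K, p ≠ q →
      List.Disjoint (F p.1 :: G p.1 p.2) (F q.1 :: G q.1 q.2)) :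
    (cycWeave F G K).Nodup := by
  rw [cycWeave, nodup_flatMap]
  exact ⟨hblk, (nodup_cycPairs hK).pairwise_of_forall_ne hdisj⟩

/-- Counting over the cyclic pairs of a weave, block by block. [folklore] -/
theorem countP_cycPairs_cycWeave (F : α → β) (G : α → α → List β) (K : List α)
    (Q : β × β → Bool) :
    (cycPairs (cycWeave F G K)).countP Q =
      ((cycPairs K).map fun p => (consecPairs (F p.1 :: G p.1 p.2 ++ [F p.2])).countP Q).sum := by
  rw [cycPairs_cycWeave, countP_flatMap, map_congr_left]
  intro p _
  rfl

/-! ### Un-weaving: block decomposition of a list -/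

/-- Group every element satisfying `P` with the maximal run of following elements violating
`P` (meant for lists whose head satisfies `P`). [folklore] -/
def blocksOf (P : α → Bool) : List α → List (α × List α)
  | [] => []
  | a :: l => (a, l.takeWhile fun x => !P x) :: blocksOf P (l.dropWhile fun x => !P x)
  termination_by l => l.length
  decreasing_by
    simp only [length_cons]
    exact Nat.lt_succ_of_le (length_dropWhile_le _ _)

/-- `blocksOf` of the empty list. [folklore] -/
@[simp] theorem blocksOf_nil (P : α → Bool) : blocksOf P ([] : List α) = [] := by
  rw [blocksOf]

/-- Unfolding `blocksOf` on a cons. [folklore] -/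
theorem blocksOf_cons (P : α → Bool) (a : α) (l : List α) :
    blocksOf P (a :: l) =
      (a, l.takeWhile fun x => !P x) :: blocksOf P (l.dropWhile fun x => !P x) := by
  rw [blocksOf]

/-- The blocks concatenate back to the list. [folklore] -/
theorem flatMap_blkList_blocksOf (P : α → Bool) : ∀ l : List α, (blocksOf P l).flatMap blkList = l
  | [] => by simp
  | a :: l => by
    rw [blocksOf_cons, flatMap_cons, blkList_mk,
      flatMap_blkList_blocksOf P (l.dropWhile fun x => !P x), cons_append,
      takeWhile_append_dropWhile]
  termination_by l => l.length
  decreasing_by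
    simp only [length_cons]
    exact Nat.lt_succ_of_le (length_dropWhile_le _ _)

/-- Filler elements of the blocks violate `P`. [folklore] -/
theorem not_of_mem_blocksOf_snd (P : α → Bool) :
    ∀ (l : List α) {b : α × List α}, b ∈ blocksOf P l → ∀ {x : α}, x ∈ b.2 → P x = false
  | [], b, hb, x, hx => by simp at hb
  | a :: l, b, hb, x, hx => by
    rw [blocksOf_cons, mem_cons] at hb
    rcases hb with rfl | hb
    · have := mem_takeWhile_imp hx
      simpa using this
    · exact not_of_mem_blocksOf_snd P (l.dropWhile fun x => !P x) hb hx
  termination_by l => l.length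
  decreasing_by
    simp only [length_cons]
    exact Nat.lt_succ_of_le (length_dropWhile_le _ _)

/-- The head of `l.dropWhile (¬ P ·)` satisfies `P`. [folklore] -/
theorem head_dropWhile_not_not (P : α → Bool) (l : List α) (h : (l.dropWhile fun x => !P x) ≠ []) :
    P ((l.dropWhile fun x => !P x).head h) = true := by
  have := head_dropWhile_not (fun x => !P x) h
  simpa using this

/-- If the head satisfies `P`, every block head satisfies `P`. [folklore] -/
theorem of_mem_blocksOf_fst (P : α → Bool) :
    ∀ (l : List α), (∀ h : l ≠ [], P (l.head h) = true) →
      ∀ {b : α × List α}, b ∈ blocksOf P l → P b.1 = true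
  | [], _, b, hb => by simp at hb
  | a :: l, hl, b, hb => by
    rw [blocksOf_cons, mem_cons] at hb
    rcases hb with rfl | hb
    · exact hl (cons_ne_nil a l)
    · exact of_mem_blocksOf_fst P (l.dropWhile fun x => !P x) (head_dropWhile_not_not P l) hb
  termination_by l => l.length
  decreasing_by
    simp only [length_cons]
    exact Nat.lt_succ_of_le (length_dropWhile_le _ _)

/-- If the head satisfies `P`, the block heads are exactly the elements satisfying `P`.
[folklore] -/
theorem map_fst_blocksOf (P : α → Bool) :
    ∀ (l : List α), (∀ h : l ≠ [], P (l.head h) = true) →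
      (blocksOf P l).map Prod.fst = l.filter P
  | [], _ => by simp
  | a :: l, hl => by
    have ha : P a = true := hl (cons_ne_nil a l)
    rw [blocksOf_cons, map_cons, filter_cons_of_pos ha,
      map_fst_blocksOf P (l.dropWhile fun x => !P x) (head_dropWhile_not_not P l)]
    congr 1
    have htw : (l.takeWhile fun x => !P x).filter P = [] := filter_eq_nil_iff.2 fun x hx => by
      have := mem_takeWhile_imp hx
      simpa using this
    conv_rhs => rw [← takeWhile_append_dropWhile (p := fun x => !P x) (l := l), filter_append, htw,
      List.nil_append]
  termination_by l => l.length
  decreasing_by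
    simp only [length_cons]
    exact Nat.lt_succ_of_le (length_dropWhile_le _ _)

/-- Along each block (closed up by the next block head) the cyclic pairs of the original list
are traversed consecutively. [folklore] -/
theorem consecPairs_blocksOf_subset (P : α → Bool) (l : List α) {b b' : α × List α}
    (h : (b, b') ∈ cycPairs (blocksOf P l)) : consecPairs (b.1 :: b.2 ++ [b'.1]) ⊆ cycPairs l := by
  intro q hq
  rw [← flatMap_blkList_blocksOf P l, cycPairs_flatMap_blkList, mem_flatMap]
  exact ⟨(b, b'), h, hq⟩

/-- **Un-weaving.** A list whose head satisfies `P` is the weave, over its `P`-elements, of the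
runs of non-`P` elements following them, provided the filler `G a b` reproduces the run after
`a` whenever `b` is the next `P`-element. [folklore] -/
theorem eq_cycWeave_filter (P : α → Bool) (l : List α) (hl : ∀ h : l ≠ [], P (l.head h) = true)
    (G : α → α → List α)
    (hG : ∀ b b' : α × List α, (b, b') ∈ cycPairs (blocksOf P l) → G b.1 b'.1 = b.2) :
    cycWeave id G (l.filter P) = l := by
  rw [← map_fst_blocksOf P l hl, cycWeave, cycPairs_map, flatMap_map]
  conv_rhs => rw [← flatMap_blkList_blocksOf P l, ← flatMap_cycPairs_fst]
  refine flatMap_congr fun q hq => ?_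
  obtain ⟨b, b'⟩ := q
  simp only [Prod.map_fst, id_eq, Prod.map_snd, blkList, cons.injEq, true_and]
  exact hG b b' hq

/-! ### Telescoping and threshold crossings along a cyclic list -/

/-- `Σ (f x - g x) = Σ f x - Σ g x` over a list. [folklore] -/
theorem sum_map_sub_eq {G : Type*} [AddCommGroup G] (f g : β → G) (L : List β) :
    (L.map fun x => f x - g x).sum = (L.map f).sum - (L.map g).sum := by
  induction L with
  | nil => simp
  | cons x L ih => rw [map_cons, map_cons, map_cons, sum_cons, sum_cons, sum_cons, ih, add_sub_add_comm]

/-- Telescoping along a cyclic list: `Σ (f b - f a)` over the cyclic pairs `(a, b)` vanishes.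
[folklore] -/
theorem sum_map_cycPairs_sub {G : Type*} [AddCommGroup G] (f : α → G) (l : List α) :
    ((cycPairs l).map fun p => f p.2 - f p.1).sum = 0 := by
  have h1 : ((cycPairs l).map fun p => f p.2) = (l.map f).rotate 1 := by
    rw [← map_rotate, ← map_snd_cycPairs, map_map]; rfl
  have h2 : ((cycPairs l).map fun p => f p.1) = l.map f := by
    conv_rhs => rw [← map_fst_cycPairs l, map_map]
    rfl
  rw [sum_map_sub_eq (fun p : α × α => f p.2) (fun p => f p.1), h1, h2, (rotate_perm _ _).sum_eq,
    sub_self]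

/-- **Up-crossings and down-crossings of a threshold along a closed sequence are
equinumerous** (what goes up must come down). [folklore] -/
theorem countP_upCross_eq_countP_downCross (f : α → ℤ) (c : ℤ) (l : List α) :
    (cycPairs l).countP (fun p => f p.1 < c ∧ c ≤ f p.2) =
      (cycPairs l).countP (fun p => f p.2 < c ∧ c ≤ f p.1) := by
  let g : α → ℤ := fun a => if c ≤ f a then 1 else 0
  have hg : ∀ p : α × α, g p.2 - g p.1 =
      (if f p.1 < c ∧ c ≤ f p.2 then 1 else 0) - (if f p.2 < c ∧ c ≤ f p.1 then 1 else 0) := by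
    intro p
    simp only [g]
    split_ifs <;> omega
  have key : ∀ L : List (α × α), ((L.map fun p => g p.2 - g p.1).sum : ℤ) =
      (L.countP fun p => f p.1 < c ∧ c ≤ f p.2) - (L.countP fun p => f p.2 < c ∧ c ≤ f p.1) := by
    intro L
    induction L with
    | nil => simp
    | cons p L ih =>
      rw [map_cons, sum_cons, ih, countP_cons, countP_cons, hg]
      simp only [decide_eq_true_eq]
      split_ifs <;> push_cast <;> omega
  have hsum := sum_map_cycPairs_sub g l
  rw [key] at hsum
  omega

/-- Along a chain for the relation "`q` takes equal values", `q` is constant. [folklore] -/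
theorem eq_of_isChain_eq_map {q : α → Bool} {l : List α} (h : IsChain (fun a b => q a = q b) l)
    {a b : α} (ha : a ∈ l) (hb : b ∈ l) : q a = q b := by
  cases l with
  | nil => simp at ha
  | cons x l =>
    have hmap : IsChain (· = ·) ((x :: l).map q) := (isChain_map q).2 h
    rw [map_cons, isChain_cons_eq_iff_eq_replicate, length_map] at hmap
    have hconst : ∀ y ∈ x :: l, q y = q x := by
      intro y hy
      rw [mem_cons] at hy
      rcases hy with rfl | hy
      · rfl
      · have : q y ∈ l.map q := mem_map_of_mem hy
        rw [hmap] at this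
        exact eq_of_mem_replicate this
    rw [hconst a ha, hconst b hb]

/-- If a threshold separates two values of `f` on a cyclic list then `f` up-crosses it along
some cyclic pair. [folklore] -/
theorem exists_upCross (f : α → ℤ) (c : ℤ) (l : List α) (ha : ∃ a ∈ l, f a < c)
    (hb : ∃ b ∈ l, c ≤ f b) : ∃ p ∈ cycPairs l, f p.1 < c ∧ c ≤ f p.2 := by
  by_contra hne
  push Not at hne
  have hup : (cycPairs l).countP (fun p => f p.1 < c ∧ c ≤ f p.2) = 0 :=
    countP_eq_zero.2 fun p hp => by simpa using hne p hp
  have hdown : (cycPairs l).countP (fun p => f p.2 < c ∧ c ≤ f p.1) = 0 := by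
    rw [← countP_upCross_eq_countP_downCross, hup]
  rw [countP_eq_zero] at hdown
  let q : α → Bool := fun a => decide (c ≤ f a)
  have hchain : IsChain (fun a b => q a = q b) l := by
    rw [isChain_iff_forall_consecPairs]
    intro p hp
    have hp' := consecPairs_subset_cycPairs l hp
    have h1 := hne p hp'
    have h2 := hdown p hp'
    simp only [decide_eq_true_eq, not_and, not_le] at h1 h2
    simp only [q]
    by_cases h : c ≤ f p.1
    · have : c ≤ f p.2 := by
        by_contra h'
        have := h2 (lt_of_not_ge h')
        omega
      simp [h, this]
    · have : ¬ c ≤ f p.2 := fun h' => by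
        have := h1 (lt_of_not_ge h)
        omega
      simp [h, this]
  obtain ⟨a, hal, hfa⟩ := ha
  obtain ⟨b, hbl, hfb⟩ := hb
  have := eq_of_isChain_eq_map hchain hal hbl
  simp only [q, decide_eq_decide] at this
  exact absurd (this.2 hfb) (not_le.2 hfa)

end Literature.Combinatorics.Enumerative
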